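import Summits.QuantumFields.YangMills.Theorems.BalabanUVNodesN19VarianceOfAnalyticTilt

/-!
# BalabanUVNodes ∕ N19′·N20 (K3⁷ v5 stub 2, hellinger road) — THE s-UNIFORM VARIANCE LETTER FROM ANALYTICITY ALONG THE INTERPOLATION SEGMENT:
# `log (Z(s)∕Z(0))` analytic on the `r`-neighbourhood of `[0,1]` with oscillation `≤ B` on each disc ⇒ `∀ s ∈ [0,1], Var_{μ_s}(h) ≤ 2B∕r²`

Cell `pub-ymgap` (HUMAN RULING D-0062 Track A; D-0154 width push R399 (3a)), seat `pub-ymgap-dag-n19-w4` (WIDTH SEAT 4 on NODE n19 = NE7) gen 5,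
CLAIM-2 ∕ INTENT-2 (pub-ymgap INBOX l.31468, 2026-08-28T07:57Z; FILE 1 = CLAIM-1 p614272 ✓ `…N19VarianceOfAnalyticTilt`).  Filed
`--kind proof --supports stmt-QuantumFields-20544 --as helper` (K3⁷ `Summit.QuantumFields.YangMills.Theses.BalabanUVNodes.SpineGivenEndpointR13SepCoPH`,
skeleton of record v5 941dddb108cbaacf); COUNT-NEUTRAL.  THEOREMS ONLY: no `def`, no `instance`, no `notation`, no `sorry`, no private decls;
imports FILE 1 only (hence Mathlib only).

WHAT THIS IS.  FILE 1 proved the crux card's (`hellinger-free-energy-road` EDITION 2, § «What it needs») First lemma: ONE run's class law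
`p = A∕Σ_T A` has `Var_p(h) ≤ 2B∕r²` as soon as a branch of the tilted log-partition function `log (Σ_T A e^{s h}∕Σ_T A)` is analytic and bounded
by `B` on the disc `|s| ≤ r`.  The road's landed CONSUMER, dag-n20-w4 g2's p612607
`…N20HellingerRoadOfVarianceAndResponse.exists_hybridNE7_of_variance_and_response`, reads the variance letter in the s-UNIFORM shape of the
edition-1 card: `hV : ∀ s ∈ [0,1], Var_{μ_s}(h) ≤ V`, `μ_s ∝ A·e^{s h}` the interpolated (tilted) class law, `h = log B − log A`; and dag-n20-w4 g2's
CLAIM-3 (`…N20VarianceCurrencyTwoSided` §3 `exists_endpointVar_le_and_not_uniformVar`, INBOX l.31411) shows that the two ENDPOINT variances do NOT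
control the interior of the segment.  THIS FILE says what does: analyticity of ONE branch `φ` of `log (Z(s)∕Z(0))` (`Z(s) = Σ_T A e^{s h}`) on a set
containing the `r`-neighbourhood of the real segment `[0,1]`, with the OSCILLATION bound `‖φ z − φ s‖ ≤ B` on each disc `|z − s| ≤ r`, gives the
s-uniform letter with `V := 2B∕r²` — in p612607's `hV` binder shape symbol for symbol (§3).  The mechanism is FILE 1 at every real tilt: `μ_{s₀}` is
again a one-run class law (weights `A e^{s₀ h} > 0`) and `z ↦ φ(s₀ + z) − φ(s₀)` is a bounded branch of ITS tilted log-partition function.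

WHAT IS PROVED ([folklore]; every step is FILE 1 BY NAME plus translation `z ↦ s₀ + z`).
* §1 `var_momentForm_eq_centred` — the two spellings of the variance agree: `Σwh²∕Σw − (Σwh∕Σw)² = Σw(h − ⟨h⟩)²∕Σw` (`Σw ≠ 0`).
* §2 ★ `variance_tilted_le_of_analytic_tilt` — at ONE real tilt `s₀`: a bounded (`≤ B`) branch `ψ` of `z ↦ log (Z(s₀+z)∕Z(s₀))` on `|z| ≤ r`, stated
  as FILE 1's tilt identity for the weights `A e^{s₀ h}`, gives `Var_{μ_{s₀}}(h) ≤ 2B∕r²` in MOMENT form · `tiltSum_shift` · `tiltSum_real` ·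
  `sum_ne_zero_of_exp_eq_at` ·
  ★ `variance_tilted_le_of_shifted_branch` — the same from ONE branch `φ` of `log (Z∕Z(0))` on the disc `closedBall (s₀:ℂ) r` with the oscillation
  bound `‖φ z − φ s₀‖ ≤ B` (`ψ z := φ(s₀+z) − φ(s₀)`; `e^{(s₀+z)h} = e^{s₀h}e^{zh}`).
* §3 ★★★ `uniformVar_le_of_analytic_on_segment` — `φ` differentiable on `U ⊇ ⋃_{s ∈ [0,1]} closedBall s r`, `exp φ = Z∕Z(0)` on `U`, oscillation `≤ B`
  on each disc ⇒ `∀ s ∈ Set.Icc 0 1, (Σ A e^{sh} h²)∕(Σ A e^{sh}) − ((Σ A e^{sh} h)∕(Σ A e^{sh}))² ≤ 2B∕r²` · ★★ `uniformVar_le_of_analytic_on_segment_logRatio`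
  — the instance `h := log B − log A`: LITERALLY the `hV` binder of p612607 ∕ p611539 (`one_sub_affinity_le_var_div_eight`,
  `target_of_variance_and_response`, `exists_hybridNE7_of_variance_and_response`) at one `(K,t)`, with `V := 2B∕r²` · `uniformVar_le_of_sup_bound_on_segment`
  (a plain sup bound `‖φ‖ ≤ B` on `U` ⇒ oscillation `≤ 2B` ⇒ `V := 4B∕r²`) · ★★ `uniformVar_le_of_tiltRatio_near_one` (BRANCH-FREE: the ratios
  `Z(s+z)∕Z(s)` within `δ ≤ ½` of `1` on `|z| ≤ r` for every `s ∈ [0,1]` ⇒ `V := 3δ∕r²`; no logarithm at all).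
* §4 toy (A6): constant observable, `φ z = z·c` on `U = univ`; the hypothesis set of §3 is inhabited.

ADJACENT TREE ∕ BUS ITEMS, CITED BY NAME, NOT RESTATED.  FILE 1 p614272 (imported); dag-n20-w4 g2 p611539 ∕ p612607 (the consumer whose `hV` this
file feeds — nothing of it restated; this file does not import it, the shapes are matched by hand so either side can cite the other) and its CLAIM-3
`…N20VarianceCurrencyTwoSided` (endpoints ⇏ interior — complementary, disjoint); my g4 p611654 (t-calculus) — disjoint.

WHAT IS NOT PROVED ∕ HONEST FRAMING.  `φ`, `U`, `B`, `r` are HYPOTHESES: that ONE run's tilted class log-partition function `log Σ_T A e^{s h}` has an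
analytic branch along the whole interpolation segment with bounded oscillation is the content of the card's (V‑b)∕(V‑c′) letters (two-run wherever
`h = log B − log A` enters; UNPRINTED for `d = 4`; one-run Kotecký–Preiss with analytic tilts INSIDE the convergence radius — nothing of it is asserted
here) — produced by nobody.  Whether the record's runs admit such a branch up to `s = 1` (i.e. whether the tilt `e^{h}` = the full two-run reweighting
stays inside the radius) is exactly the physics the road has to supply; dag-n20-w4's witness shows it is NOT automatic from the endpoints.  The file
proves NO estimate of the programme; nothing of Bałaban's is asserted, read off a datum or instantiated (A6: no antecedent mentions a Bałaban object;
A2: §4 shows the hypothesis set inhabited).  NE7 ∕ NE7b ∕ NE7c NOT PRINTED as two-run statements for `d = 4`, NOT proved; N19 ∕ N20 ∕ N21 NOT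
discharged; K3⁷ OPEN, v5 STANDS, not claimed; counts unmoved (typed 28∕28 · discharged 5∕27, A 5∕28); no count claim; no summit statement is proved by
this seat.  One finite `𝕋⁴` programme at fixed `ε`, Bałaban AS PRINTED; R4 closes the CONDITIONAL finite-𝕋⁴ rung `BalabanLadder.UV` only — NOT ℝ⁴, NOT
continuum, NOT OS; the Yang–Mills mass gap (Clay) is NOT proved by any of this.  Sources (location only, folklore analysis): Cauchy's estimate —
Mathlib `Mathlib/Analysis/Complex/Liouville.lean`; the `hV` letter shape — `Theorems/BalabanUVNodesN20HellingerRoadOfVarianceAndResponse.lean` (p612607)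
and the crux card § «What it needs» K1 ∕ P2.
-/

namespace Summit.QuantumFields.YangMills.BalabanUVNodes.N19VarianceOfAnalyticTiltFamily

open Finset Set Metric
open Summit.QuantumFields.YangMills.BalabanUVNodes.N19VarianceOfAnalyticTilt

/-! ## §1 The two spellings of the variance -/

/-- `Σ_T w h² ∕ Σ_T w − (Σ_T w h ∕ Σ_T w)² = Σ_T w (h − ⟨h⟩_w)² ∕ Σ_T w` (`Σ_T w ≠ 0`): the MOMENT form used by the road's consumer
(p612607's `hV`) and the CENTRED form of FILE 1 agree. -/
theorem var_momentForm_eq_centred {ι : Type*} (T : Finset ι) (w h : ι → ℝ) (hS : (∑ τ ∈ T, w τ) ≠ 0) :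
    (∑ τ ∈ T, w τ * h τ ^ 2) / (∑ τ ∈ T, w τ) - ((∑ τ ∈ T, w τ * h τ) / ∑ τ ∈ T, w τ) ^ 2
      = (∑ τ ∈ T, w τ * (h τ - (∑ σ ∈ T, w σ * h σ) / ∑ σ ∈ T, w σ) ^ 2) / ∑ τ ∈ T, w τ := by
  rw [sum_mul_sub_mean_sq T w h hS]
  field_simp

/-! ## §2 One real tilt `s₀`: the tilted law is again a one-run class law -/

/-- ★ **VARIANCE AT ONE TILT.**  `A > 0` on `T`, `h : ι → ℝ`, `s₀ : ℝ`; the tilted weights `A e^{s₀ h}` are positive, so FILE 1 applies to THEM: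
a branch `ψ`, complex differentiable on `|z| ≤ r` (`0 < r`), of the tilted log-partition function of the law `μ_{s₀} ∝ A e^{s₀ h}` —
`exp (ψ z) = Σ_T A e^{s₀h} e^{zh} ∕ Σ_T A e^{s₀h}` (`= Z(s₀+z)∕Z(s₀)`) — bounded by `B`, gives `Var_{μ_{s₀}}(h) ≤ 2B∕r²`, here in MOMENT form
`Σ A e^{s₀h} h² ∕ Σ A e^{s₀h} − (Σ A e^{s₀h} h ∕ Σ A e^{s₀h})²`. -/
theorem variance_tilted_le_of_analytic_tilt {ι : Type*} (T : Finset ι) (A h : ι → ℝ) (hA : ∀ τ ∈ T, 0 < A τ) (s₀ : ℝ)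
    {r B : ℝ} (hr : 0 < r) (ψ : ℂ → ℂ) (hψ : DifferentiableOn ℂ ψ (Metric.closedBall 0 r))
    (hexp : ∀ z ∈ Metric.closedBall (0:ℂ) r, Complex.exp (ψ z) =
      (∑ τ ∈ T, ((A τ * Real.exp (s₀ * h τ) : ℝ) : ℂ) * Complex.exp (z * (h τ : ℂ))) /
        ∑ τ ∈ T, ((A τ * Real.exp (s₀ * h τ) : ℝ) : ℂ))
    (hB : ∀ z ∈ Metric.closedBall (0:ℂ) r, ‖ψ z‖ ≤ B) :
    (∑ τ ∈ T, A τ * Real.exp (s₀ * h τ) * h τ ^ 2) / (∑ τ ∈ T, A τ * Real.exp (s₀ * h τ))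
      - ((∑ τ ∈ T, A τ * Real.exp (s₀ * h τ) * h τ) / ∑ τ ∈ T, A τ * Real.exp (s₀ * h τ)) ^ 2
      ≤ 2 * B / r ^ 2 := by
  have hw : ∀ τ ∈ T, 0 < A τ * Real.exp (s₀ * h τ) := fun τ hτ => mul_pos (hA τ hτ) (Real.exp_pos _)
  have hS : (∑ τ ∈ T, A τ * Real.exp (s₀ * h τ)) ≠ 0 :=
    sum_ne_zero_of_exp_eq_real T (fun τ => A τ * Real.exp (s₀ * h τ)) h hr.le ψ hexp
  have key : (∑ τ ∈ T, A τ * Real.exp (s₀ * h τ) *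
      (h τ - (∑ σ ∈ T, A σ * Real.exp (s₀ * h σ) * h σ) / ∑ σ ∈ T, A σ * Real.exp (s₀ * h σ)) ^ 2)
        / (∑ τ ∈ T, A τ * Real.exp (s₀ * h τ)) ≤ 2 * B / r ^ 2 :=
    variance_le_of_analytic_tilt_sharp T (fun τ => A τ * Real.exp (s₀ * h τ)) h hw hr ψ hψ hexp hB
  rw [var_momentForm_eq_centred T (fun τ => A τ * Real.exp (s₀ * h τ)) h hS]
  exact key

/-- Shifting the tilt: `Σ_T A·e^{(s₀+z)h} = Σ_T (A e^{s₀h})·e^{zh}` (real `s₀`, complex `z`; `e^{(s₀+z)h} = e^{s₀h}e^{zh}`). -/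
theorem tiltSum_shift {ι : Type*} (T : Finset ι) (A h : ι → ℝ) (s₀ : ℝ) (z : ℂ) :
    (∑ τ ∈ T, (A τ : ℂ) * Complex.exp (((s₀ : ℂ) + z) * (h τ : ℂ)))
      = ∑ τ ∈ T, ((A τ * Real.exp (s₀ * h τ) : ℝ) : ℂ) * Complex.exp (z * (h τ : ℂ)) := by
  refine Finset.sum_congr rfl fun τ _ => ?_
  push_cast
  rw [add_mul, Complex.exp_add]
  ring

/-- At a real tilt the tilted sum is the real sum of the tilted weights: `Σ_T A·e^{s₀h} = Σ_T (A e^{s₀h} : ℝ)` (cast). -/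
theorem tiltSum_real {ι : Type*} (T : Finset ι) (A h : ι → ℝ) (s₀ : ℝ) :
    (∑ τ ∈ T, (A τ : ℂ) * Complex.exp ((s₀ : ℂ) * (h τ : ℂ)))
      = ∑ τ ∈ T, ((A τ * Real.exp (s₀ * h τ) : ℝ) : ℂ) := by
  refine Finset.sum_congr rfl fun τ _ => ?_
  push_cast
  ring

/-- Under the tilt identity `exp (φ z) = Z(z)∕Σ_T A` at ONE point the normalising sum `Σ_T (A τ : ℂ)` is nonzero. -/
theorem sum_ne_zero_of_exp_eq_at {ι : Type*} (T : Finset ι) (A h : ι → ℝ) (φ : ℂ → ℂ) (z : ℂ)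
    (hexp : Complex.exp (φ z) = (∑ τ ∈ T, (A τ : ℂ) * Complex.exp (z * (h τ : ℂ))) / ∑ τ ∈ T, (A τ : ℂ)) :
    (∑ τ ∈ T, (A τ : ℂ)) ≠ 0 := by
  intro h0
  rw [h0, div_zero] at hexp
  exact Complex.exp_ne_zero _ hexp

/-- ★ **VARIANCE AT ONE TILT FROM A SHIFTED BRANCH.**  `A > 0` on `T`, `h : ι → ℝ`, `s₀ : ℝ`, `0 < r`; ONE branch `φ` of the tilted
log-partition function of `p = A∕Σ A` — `exp (φ z) = Σ_T A e^{zh} ∕ Σ_T A` — complex differentiable on the disc `closedBall (s₀:ℂ) r` around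
the REAL tilt `s₀`, with the OSCILLATION bound `‖φ z − φ s₀‖ ≤ B` there, gives `Var_{μ_{s₀}}(h) ≤ 2B∕r²` (moment form).  Route:
`ψ z := φ(s₀ + z) − φ(s₀)` is a branch for the tilted weights `A e^{s₀h}` (`e^{(s₀+z)h} = e^{s₀h}·e^{zh}`), bounded by `B`; apply
`variance_tilted_le_of_analytic_tilt`. -/
theorem variance_tilted_le_of_shifted_branch {ι : Type*} (T : Finset ι) (A h : ι → ℝ) (hA : ∀ τ ∈ T, 0 < A τ) (s₀ : ℝ)
    {r B : ℝ} (hr : 0 < r) (φ : ℂ → ℂ) (hφ : DifferentiableOn ℂ φ (Metric.closedBall (s₀:ℂ) r))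
    (hexp : ∀ z ∈ Metric.closedBall (s₀:ℂ) r, Complex.exp (φ z) =
      (∑ τ ∈ T, (A τ : ℂ) * Complex.exp (z * (h τ : ℂ))) / ∑ τ ∈ T, (A τ : ℂ))
    (hosc : ∀ z ∈ Metric.closedBall (s₀:ℂ) r, ‖φ z - φ s₀‖ ≤ B) :
    (∑ τ ∈ T, A τ * Real.exp (s₀ * h τ) * h τ ^ 2) / (∑ τ ∈ T, A τ * Real.exp (s₀ * h τ))
      - ((∑ τ ∈ T, A τ * Real.exp (s₀ * h τ) * h τ) / ∑ τ ∈ T, A τ * Real.exp (s₀ * h τ)) ^ 2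
      ≤ 2 * B / r ^ 2 := by
  have hs₀ : (s₀ : ℂ) ∈ Metric.closedBall (s₀:ℂ) r := mem_closedBall_self hr.le
  have hS : (∑ τ ∈ T, (A τ : ℂ)) ≠ 0 := sum_ne_zero_of_exp_eq_at T A h φ s₀ (hexp _ hs₀)
  -- translation `z ↦ s₀ + z` maps the disc at `0` onto the disc at `s₀`
  have hmaps : ∀ z ∈ Metric.closedBall (0:ℂ) r, (s₀ : ℂ) + z ∈ Metric.closedBall (s₀:ℂ) r := by
    intro z hz
    rw [mem_closedBall, dist_eq_norm] at hz ⊢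
    simpa using hz
  -- the shifted branch
  have hψ : DifferentiableOn ℂ (fun z : ℂ => φ ((s₀ : ℂ) + z) - φ s₀) (Metric.closedBall 0 r) := by
    refine DifferentiableOn.sub_const ?_ _
    exact hφ.comp ((differentiable_id.const_add (s₀ : ℂ)).differentiableOn) (fun z hz => hmaps z hz)
  have hexpψ : ∀ z ∈ Metric.closedBall (0:ℂ) r, Complex.exp (φ ((s₀ : ℂ) + z) - φ s₀) =
      (∑ τ ∈ T, ((A τ * Real.exp (s₀ * h τ) : ℝ) : ℂ) * Complex.exp (z * (h τ : ℂ))) /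
        ∑ τ ∈ T, ((A τ * Real.exp (s₀ * h τ) : ℝ) : ℂ) := by
    intro z hz
    rw [Complex.exp_sub, hexp _ (hmaps z hz), hexp _ hs₀, div_div_div_cancel_right₀ hS, tiltSum_shift, tiltSum_real]
  have hBψ : ∀ z ∈ Metric.closedBall (0:ℂ) r, ‖φ ((s₀ : ℂ) + z) - φ s₀‖ ≤ B :=
    fun z hz => hosc _ (hmaps z hz)
  exact variance_tilted_le_of_analytic_tilt T A h hA s₀ hr _ hψ hexpψ hBψ

/-! ## §3 ★★★ The s-uniform letter along the interpolation segment `[0,1]` -/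

/-- ★★★ **THE s-UNIFORM VARIANCE LETTER FROM ANALYTICITY ALONG THE SEGMENT.**  `A > 0` on `T`, `h : ι → ℝ`, `0 < r`; ONE branch `φ` of
`log (Σ_T A e^{zh} ∕ Σ_T A)`, complex differentiable on a set `U` containing every disc `closedBall (s:ℂ) r`, `s ∈ [0,1]` (the `r`-neighbourhood
of the interpolation segment), with oscillation `‖φ z − φ s‖ ≤ B` on each such disc ⇒ for EVERY `s ∈ [0,1]` the tilted law `μ_s ∝ A e^{s h}`
has `Var_{μ_s}(h) ≤ 2B∕r²` — moment form, i.e. the road consumer's `hV` binder (p612607 `exists_hybridNE7_of_variance_and_response`) at one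
`(K,t)` with `V := 2B∕r²` and a general observable `h`. -/
theorem uniformVar_le_of_analytic_on_segment {ι : Type*} (T : Finset ι) (A h : ι → ℝ) (hA : ∀ τ ∈ T, 0 < A τ)
    {U : Set ℂ} {r B : ℝ} (hr : 0 < r) (φ : ℂ → ℂ) (hφ : DifferentiableOn ℂ φ U)
    (hU : ∀ s ∈ Set.Icc (0:ℝ) 1, Metric.closedBall (s:ℂ) r ⊆ U)
    (hexp : ∀ z ∈ U, Complex.exp (φ z) = (∑ τ ∈ T, (A τ : ℂ) * Complex.exp (z * (h τ : ℂ))) / ∑ τ ∈ T, (A τ : ℂ))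
    (hosc : ∀ s ∈ Set.Icc (0:ℝ) 1, ∀ z ∈ Metric.closedBall (s:ℂ) r, ‖φ z - φ s‖ ≤ B) :
    ∀ s ∈ Set.Icc (0:ℝ) 1,
      (∑ τ ∈ T, A τ * Real.exp (s * h τ) * h τ ^ 2) / (∑ τ ∈ T, A τ * Real.exp (s * h τ))
        - ((∑ τ ∈ T, A τ * Real.exp (s * h τ) * h τ) / ∑ τ ∈ T, A τ * Real.exp (s * h τ)) ^ 2
        ≤ 2 * B / r ^ 2 :=
  fun s hs => variance_tilted_le_of_shifted_branch T A h hA s hr φ (hφ.mono (hU s hs))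
    (fun z hz => hexp z (hU s hs hz)) (hosc s hs)

/-- ★★ **THE `hV` LETTER OF THE ROAD'S CONSUMER, LITERALLY.**  Two runs' positive class weights `A, B` on `T`, `h := log B − log A` (so the tilt
`A e^{s h} = A^{1−s} B^s` interpolates the two runs' class weights): a branch `φ` of `log (Σ_T A e^{z(log B − log A)} ∕ Σ_T A)` analytic on
`U ⊇ ⋃_{s∈[0,1]} closedBall s r` with oscillation `≤ M` on each disc ⇒
`∀ s ∈ [0,1], Σ A e^{s(log B−log A)}(log B−log A)² ∕ Σ A e^{s(log B−log A)} − (Σ A e^{s(log B−log A)}(log B−log A) ∕ Σ A e^{s(log B−log A)})² ≤ 2M∕r²`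
— the hypothesis `hV` of p611539 `one_sub_affinity_le_var_div_eight` ∕ p612607 `target_of_variance_and_response` ∕
`exists_hybridNE7_of_variance_and_response` at one `(K,t)`, with `V := 2M∕r²`.  (Positivity of `B` is not used: `h` is any real observable.) -/
theorem uniformVar_le_of_analytic_on_segment_logRatio {ι : Type*} (T : Finset ι) (A B : ι → ℝ) (hA : ∀ τ ∈ T, 0 < A τ)
    {U : Set ℂ} {r M : ℝ} (hr : 0 < r) (φ : ℂ → ℂ) (hφ : DifferentiableOn ℂ φ U)
    (hU : ∀ s ∈ Set.Icc (0:ℝ) 1, Metric.closedBall (s:ℂ) r ⊆ U)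
    (hexp : ∀ z ∈ U, Complex.exp (φ z) =
      (∑ τ ∈ T, (A τ : ℂ) * Complex.exp (z * ((Real.log (B τ) - Real.log (A τ) : ℝ) : ℂ))) / ∑ τ ∈ T, (A τ : ℂ))
    (hosc : ∀ s ∈ Set.Icc (0:ℝ) 1, ∀ z ∈ Metric.closedBall (s:ℂ) r, ‖φ z - φ s‖ ≤ M) :
    ∀ s ∈ Set.Icc (0:ℝ) 1,
      (∑ τ ∈ T, A τ * Real.exp (s * (Real.log (B τ) - Real.log (A τ))) * (Real.log (B τ) - Real.log (A τ)) ^ 2)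
          / (∑ τ ∈ T, A τ * Real.exp (s * (Real.log (B τ) - Real.log (A τ))))
        - ((∑ τ ∈ T, A τ * Real.exp (s * (Real.log (B τ) - Real.log (A τ))) * (Real.log (B τ) - Real.log (A τ)))
          / (∑ τ ∈ T, A τ * Real.exp (s * (Real.log (B τ) - Real.log (A τ))))) ^ 2 ≤ 2 * M / r ^ 2 :=
  uniformVar_le_of_analytic_on_segment T A (fun τ => Real.log (B τ) - Real.log (A τ)) hA hr φ hφ hU hexp hosc

/-- The SUP-BOUND variant: if the branch is bounded outright, `‖φ z‖ ≤ B` on `U`, the oscillation on each disc is `≤ 2B` and the s-uniform letter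
holds with `V := 4B∕r²`. -/
theorem uniformVar_le_of_sup_bound_on_segment {ι : Type*} (T : Finset ι) (A h : ι → ℝ) (hA : ∀ τ ∈ T, 0 < A τ)
    {U : Set ℂ} {r B : ℝ} (hr : 0 < r) (φ : ℂ → ℂ) (hφ : DifferentiableOn ℂ φ U)
    (hU : ∀ s ∈ Set.Icc (0:ℝ) 1, Metric.closedBall (s:ℂ) r ⊆ U)
    (hexp : ∀ z ∈ U, Complex.exp (φ z) = (∑ τ ∈ T, (A τ : ℂ) * Complex.exp (z * (h τ : ℂ))) / ∑ τ ∈ T, (A τ : ℂ))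
    (hB : ∀ z ∈ U, ‖φ z‖ ≤ B) :
    ∀ s ∈ Set.Icc (0:ℝ) 1,
      (∑ τ ∈ T, A τ * Real.exp (s * h τ) * h τ ^ 2) / (∑ τ ∈ T, A τ * Real.exp (s * h τ))
        - ((∑ τ ∈ T, A τ * Real.exp (s * h τ) * h τ) / ∑ τ ∈ T, A τ * Real.exp (s * h τ)) ^ 2
        ≤ 4 * B / r ^ 2 := by
  have hosc : ∀ s ∈ Set.Icc (0:ℝ) 1, ∀ z ∈ Metric.closedBall (s:ℂ) r, ‖φ z - φ s‖ ≤ 2 * B := by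
    intro s hs z hz
    have h1 := hB z (hU s hs hz)
    have h2 := hB s (hU s hs (mem_closedBall_self hr.le))
    calc ‖φ z - φ s‖ ≤ ‖φ z‖ + ‖φ s‖ := norm_sub_le _ _
      _ ≤ 2 * B := by linarith
  intro s hs
  have := uniformVar_le_of_analytic_on_segment T A h hA hr φ hφ hU hexp hosc s hs
  calc _ ≤ 2 * (2 * B) / r ^ 2 := this
    _ = 4 * B / r ^ 2 := by ring

/-- ★★ **BRANCH-FREE s-UNIFORM LETTER (tilted partition-function RATIOS near one).**  `A > 0` on `T`, `h : ι → ℝ`, `0 < r`, `δ ≤ ½`: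
if for every `s ∈ [0,1]` the ratio `Z(s+z)∕Z(s)` (`Z(w) = Σ_T A e^{wh}`) stays within `δ` of `1` on the complex disc `|z| ≤ r`, then
`∀ s ∈ [0,1], Var_{μ_s}(h) ≤ 3δ∕r²` (moment form) — FILE 1's `variance_le_of_mgf_near_one` at the tilted weights `A e^{sh}`; no logarithm,
no branch: the consumer bounds ratios of tilted partition functions on small complex discs around the real segment. -/
theorem uniformVar_le_of_tiltRatio_near_one {ι : Type*} (T : Finset ι) (A h : ι → ℝ) (hA : ∀ τ ∈ T, 0 < A τ)
    {r δ : ℝ} (hr : 0 < r) (hδ : δ ≤ 1 / 2)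
    (hnear : ∀ s ∈ Set.Icc (0:ℝ) 1, ∀ z ∈ Metric.closedBall (0:ℂ) r,
      ‖(∑ τ ∈ T, (A τ : ℂ) * Complex.exp (((s : ℂ) + z) * (h τ : ℂ))) /
          (∑ τ ∈ T, (A τ : ℂ) * Complex.exp ((s : ℂ) * (h τ : ℂ))) - 1‖ ≤ δ) :
    ∀ s ∈ Set.Icc (0:ℝ) 1,
      (∑ τ ∈ T, A τ * Real.exp (s * h τ) * h τ ^ 2) / (∑ τ ∈ T, A τ * Real.exp (s * h τ))
        - ((∑ τ ∈ T, A τ * Real.exp (s * h τ) * h τ) / ∑ τ ∈ T, A τ * Real.exp (s * h τ)) ^ 2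
        ≤ 3 * δ / r ^ 2 := by
  intro s hs
  have hw : ∀ τ ∈ T, 0 < A τ * Real.exp (s * h τ) := fun τ hτ => mul_pos (hA τ hτ) (Real.exp_pos _)
  have hnear' : ∀ z ∈ Metric.closedBall (0:ℂ) r,
      ‖(∑ τ ∈ T, ((A τ * Real.exp (s * h τ) : ℝ) : ℂ) * Complex.exp (z * (h τ : ℂ))) /
          (∑ τ ∈ T, ((A τ * Real.exp (s * h τ) : ℝ) : ℂ)) - 1‖ ≤ δ := by
    intro z hz
    rw [← tiltSum_shift, ← tiltSum_real]
    exact hnear s hs z hz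
  -- `T` is nonempty (else the ratio is `0∕0 = 0`, at distance `1 > δ` from `1`), so the tilted normalising sum is nonzero
  have hS : (∑ τ ∈ T, A τ * Real.exp (s * h τ)) ≠ 0 := by
    rcases T.eq_empty_or_nonempty with hT | hT
    · exfalso
      have h0 := hnear' 0 (mem_closedBall_self hr.le)
      simp [hT] at h0
      linarith
    · exact (Finset.sum_pos hw hT).ne'
  have key : (∑ τ ∈ T, A τ * Real.exp (s * h τ) *
      (h τ - (∑ σ ∈ T, A σ * Real.exp (s * h σ) * h σ) / ∑ σ ∈ T, A σ * Real.exp (s * h σ)) ^ 2)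
        / (∑ τ ∈ T, A τ * Real.exp (s * h τ)) ≤ 3 * δ / r ^ 2 :=
    variance_le_of_mgf_near_one T (fun τ => A τ * Real.exp (s * h τ)) h hw hr hδ hnear'
  rw [var_momentForm_eq_centred T (fun τ => A τ * Real.exp (s * h τ)) h hS]
  exact key

/-! ## §4 Toy (A6): the hypothesis set of §3 is inhabited -/

/-- Toy: one class, weight `A = 1`, constant observable `h = c`; `φ z := z·c` is an entire branch (`U = univ`) with oscillation
`‖φ z − φ s‖ = |c|·‖z − s‖ ≤ |c|·r` on each disc; §3 applies and returns `Var_{μ_s}(c) ≤ 2|c|r∕r²` for every `s ∈ [0,1]` (the left side is `0`).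
Non-vacuity witness only. -/
theorem toy_uniformVar_constant (c : ℝ) {r : ℝ} (hr : 0 < r) (A h : Unit → ℝ) (hA1 : A = fun _ => 1)
    (hhc : h = fun _ => c) :
    ∀ s ∈ Set.Icc (0:ℝ) 1,
      (∑ τ ∈ (Finset.univ : Finset Unit), A τ * Real.exp (s * h τ) * h τ ^ 2) / (∑ τ ∈ (Finset.univ : Finset Unit), A τ * Real.exp (s * h τ))
        - ((∑ τ ∈ (Finset.univ : Finset Unit), A τ * Real.exp (s * h τ) * h τ)
            / ∑ τ ∈ (Finset.univ : Finset Unit), A τ * Real.exp (s * h τ)) ^ 2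
        ≤ 2 * (|c| * r) / r ^ 2 := by
  subst hA1 hhc
  refine uniformVar_le_of_analytic_on_segment (Finset.univ : Finset Unit) (fun _ => (1 : ℝ)) (fun _ => c)
    (fun _ _ => one_pos) (U := Set.univ) hr (fun z => z * (c : ℂ)) ?_ (fun _ _ => Set.subset_univ _) ?_ ?_
  · exact (differentiable_id.mul_const (c : ℂ)).differentiableOn
  · intro z _
    simp
  · intro s _ z hz
    rw [← sub_mul, norm_mul, Complex.norm_real, Real.norm_eq_abs, mul_comm]
    have : ‖z - (s : ℂ)‖ ≤ r := by rwa [mem_closedBall, dist_eq_norm] at hz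
    exact mul_le_mul_of_nonneg_left this (abs_nonneg c)

end Summit.QuantumFields.YangMills.BalabanUVNodes.N19VarianceOfAnalyticTiltFamily
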